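import Literature.Analysis.FluidPDE.TorusConvectionBounds
import HarnessLib

/-!
# The tame commutator estimate for pure derivatives of the convective derivative on `T³`

Analysis/FluidPDE support file for the energy-method construction of Euler flows in the
periodic cylinder (`Literature.Analysis.FluidPDE.KatoLai1984_periodicCylinderUniformExistence`).
It is the calculus inequality behind Kato–Lai's (4.5) and (5.8) (Kato–Lai 1984, §4:
`|(u | F(v, u))_s| ≤ c (‖v‖_{s₀} ‖u‖²_s + ‖v‖_s ‖v‖_{s₀} ‖u‖_s)`-type bounds with `s₀ = 3`, "more
or less well known"; Majda–Bertozzi 2002, Prop. 3.7): for smooth real fields `W, U` on the flat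
torus `T^d`, `card d = 3`, every coordinate `i` and every `m ≥ 3`,

  `|∫ ⟪∂ᵢᵐ[(W·∇)U], ∂ᵢᵐ U⟫| ≤ C(m) (√(latNormSq 3 W) latNormSq m U`
  `                              + √(latNormSq m W) √(latNormSq 3 U) √(latNormSq m U))`

(`exists_abs_integral_inner_iterate_convect_le`), **tame** (one factor only at level `3`) and
**without any solenoidality or boundary hypothesis on `W`** (the transport term carries
`‖div W‖_∞`). Proof: the Leibniz formula `∂ᵢᵐ[(W·∇)U] = ∑ₐ (m choose a) ((∂ᵢᵃW)·∇) ∂ᵢ^{m-a}U`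
(`Torus.iterate_partialDeriv_convect`); `a = 0` is the transport term (`-½ ∫ |∂ᵢᵐU|² div W`),
`a = 1` and `a = m` take a sup norm on the low factor (`H² ⊂ L^∞`), the middle terms are
`L⁴ × L⁴ × L²` (`H¹ ⊂ L⁴`) followed by log-convex interpolation of the levels and Young's
inequality (`Torus.latProd_le_tame`). Also the order-zero pairing
`|∫ ⟪(W·∇)U, U⟫| ≤ C √(latNormSq 3 W) latNormSq 0 U` (`exists_abs_integral_inner_convect_le`).

Everything is proved; no named fact and no `sorry` is introduced. Constants are existential.

## Mathlib / tree search

Tree: `Torus.iterate_partialDeriv_convect`, `Torus.isSmooth_iterate_partialDeriv`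
(`EulerGalerkinLeibniz`), `Torus.wordDeriv_replicate` (`TorusWordSobolev`), the bounds of
`TorusConvectionBounds` and `TorusLatticeNorms`.

## References

* T. Kato, C. Y. Lai, J. Funct. Anal. 56 (1984) 15–28, §4 (4.5), §5 (5.8). [KatoLai1984]
* A. J. Majda, A. L. Bertozzi, *Vorticity and Incompressible Flow*, CUP 2002, §3.2, Prop. 3.7.
  [MajdaBertozziCUP2002]
-/

noncomputable section

open Filter Topology TopologicalSpace Finset MeasureTheory UnitAddTorus
open scoped ENNReal NNReal InnerProductSpace

namespace Literature.Analysis.FluidPDE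

namespace Torus

open FunctionSpaces FunctionSpaces.Torus GalerkinSmooth

universe u

variable {d : Type u} [Fintype d] [DecidableEq d]

/-! ### Bookkeeping -/

/-- `√(x + y) ≤ √x + √y`. [folklore] -/
private theorem sqrt_add_le_sqrt_add_sqrt {x y : ℝ} (hx : 0 ≤ x) (hy : 0 ≤ y) :
    Real.sqrt (x + y) ≤ Real.sqrt x + Real.sqrt y := by
  have h : x + y ≤ (Real.sqrt x + Real.sqrt y) ^ 2 := by
    nlinarith [Real.sq_sqrt hx, Real.sq_sqrt hy, Real.sqrt_nonneg x, Real.sqrt_nonneg y]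
  calc Real.sqrt (x + y) ≤ Real.sqrt ((Real.sqrt x + Real.sqrt y) ^ 2) := Real.sqrt_le_sqrt h
    _ = Real.sqrt x + Real.sqrt y := Real.sqrt_sq (add_nonneg (Real.sqrt_nonneg _) (Real.sqrt_nonneg _))

variable {W U : UnitAddTorus d → EuclideanSpace ℝ d}

/-- Lattice energies of pure iterated derivatives: `latNormSq k (∂ᵢᵃ u) ≤ (4π²)ᵃ latNormSq (k + a) u`.
[folklore] -/
theorem latNormSq_iterate_le (hu : IsSmooth U) (k a : ℕ) (i : d) :
    latNormSq k ((Torus.partialDeriv i)^[a] U) ≤ (4 * Real.pi ^ 2) ^ a * latNormSq (k + a) U := by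
  have := latNormSq_wordDeriv_le hu k (List.replicate a i)
  rwa [wordDeriv_replicate, List.length_replicate] at this

/-- `∫ ‖∂ᵢᵐ u‖² ≤ (4π²)ᵐ latNormSq m u`. [folklore] -/
theorem integral_norm_sq_iterate_le (hu : IsSmooth U) (m : ℕ) (i : d) :
    ∫ x, ‖(Torus.partialDeriv i)^[m] U x‖ ^ 2 ≤ (4 * Real.pi ^ 2) ^ m * latNormSq m U := by
  have := integral_norm_sq_wordDeriv_le_latNormSq hu (w := List.replicate m i) (m := m) (by simp)
  rwa [wordDeriv_replicate] at this

/-- `√(∫ ‖∂ᵢᵐ u‖²) ≤ (2π)ᵐ-type bound: `≤ √((4π²)ᵐ) √(latNormSq m u)`. [folklore] -/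
theorem sqrt_integral_norm_sq_iterate_le (hu : IsSmooth U) (m : ℕ) (i : d) :
    Real.sqrt (∫ x, ‖(Torus.partialDeriv i)^[m] U x‖ ^ 2) ≤
      Real.sqrt ((4 * Real.pi ^ 2) ^ m) * Real.sqrt (latNormSq m U) := by
  rw [← Real.sqrt_mul (by positivity)]
  exact Real.sqrt_le_sqrt (integral_norm_sq_iterate_le hu m i)

/-! ### The pairing as a binomial sum -/

/-- **Leibniz under the integral**:
`∫ ⟪∂ᵢᵐ[(W·∇)U], z⟫ = ∑ₐ (m choose a) ∫ ⟪((∂ᵢᵃW)·∇)(∂ᵢ^{m-a}U), z⟫`. [folklore] -/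
theorem integral_inner_iterate_convect_eq_sum (hW : IsSmooth W) (hU : IsSmooth U) {z : UnitAddTorus d → EuclideanSpace ℝ d}
    (hz : IsSmooth z) (i : d) (m : ℕ) :
    ∫ x, ⟪(Torus.partialDeriv i)^[m] (Torus.convect W U) x, z x⟫_ℝ =
      ∑ a ∈ range (m + 1), (m.choose a : ℝ) *
        ∫ x, ⟪Torus.convect ((Torus.partialDeriv i)^[a] W) ((Torus.partialDeriv i)^[m - a] U) x, z x⟫_ℝ := by
  rw [iterate_partialDeriv_convect hW hU i m]
  have hterm : ∀ a, IsSmooth (Torus.convect ((Torus.partialDeriv i)^[a] W) ((Torus.partialDeriv i)^[m - a] U)) :=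
    fun a => (isSmooth_iterate_partialDeriv hW i a).convect (isSmooth_iterate_partialDeriv hU i _)
  have hint : ∀ a, Integrable (fun x => (m.choose a : ℝ) *
      ⟪Torus.convect ((Torus.partialDeriv i)^[a] W) ((Torus.partialDeriv i)^[m - a] U) x, z x⟫_ℝ) volume :=
    fun a => (((hterm a).inner hz).integrable).const_mul _
  have hpt : ∀ x, ⟪(∑ a ∈ range (m + 1), (m.choose a) •
      Torus.convect ((Torus.partialDeriv i)^[a] W) ((Torus.partialDeriv i)^[m - a] U)) x, z x⟫_ℝ =
      ∑ a ∈ range (m + 1), (m.choose a : ℝ) *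
        ⟪Torus.convect ((Torus.partialDeriv i)^[a] W) ((Torus.partialDeriv i)^[m - a] U) x, z x⟫_ℝ := by
    intro x
    rw [Finset.sum_apply, sum_inner]
    refine sum_congr rfl fun a _ => ?_
    rw [Pi.smul_apply, ← Nat.cast_smul_eq_nsmul ℝ, real_inner_smul_left]
  simp_rw [hpt]
  rw [integral_finsetSum _ fun a _ => hint a]
  exact sum_congr rfl fun a _ => integral_const_mul _ _

/-! ### The order-zero pairing -/

/-- **`|∫ ⟪(W·∇)U, U⟫| ≤ C √(latNormSq 3 W) latNormSq 0 U`.** [folklore] -/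
theorem exists_abs_integral_inner_convect_le (hd : Fintype.card d = 3) : ∃ C : ℝ, 0 ≤ C ∧
    ∀ (W U : UnitAddTorus d → EuclideanSpace ℝ d), IsSmooth W → IsSmooth U →
      |∫ x, ⟪Torus.convect W U x, U x⟫_ℝ| ≤ C * Real.sqrt (latNormSq 3 W) * latNormSq 0 U := by
  obtain ⟨C, hC0, hC⟩ := exists_abs_divergence_le (d := d) hd
  refine ⟨2⁻¹ * C, by positivity, fun W U hW hU => ?_⟩
  have h := abs_integral_inner_convect_self_le_of_div hW hU (hC W hW)
  rw [← latNormSq_zero hU] at h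
  calc |∫ x, ⟪Torus.convect W U x, U x⟫_ℝ| ≤ 2⁻¹ * (C * Real.sqrt (latNormSq 3 W)) * latNormSq 0 U := h
    _ = _ := by ring

/-! ### The tame commutator estimate -/

/-- The target quantity `X = √(lat₃ W) latₘ U + √(latₘ W) √(lat₃ U) √(latₘ U)`. [folklore] -/
def tameRHS (m : ℕ) (W U : UnitAddTorus d → EuclideanSpace ℝ d) : ℝ :=
  Real.sqrt (latNormSq 3 W) * latNormSq m U +
    Real.sqrt (latNormSq m W) * Real.sqrt (latNormSq 3 U) * Real.sqrt (latNormSq m U)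

omit [DecidableEq d] in
/-- `X ≥ 0`. [folklore] -/
theorem tameRHS_nonneg (m : ℕ) (W U : UnitAddTorus d → EuclideanSpace ℝ d) : 0 ≤ tameRHS m W U := by
  have := latNormSq_nonneg m U
  unfold tameRHS; positivity

omit [DecidableEq d] in
/-- The first summand is below `X`. [folklore] -/
theorem fst_le_tameRHS (m : ℕ) (W U : UnitAddTorus d → EuclideanSpace ℝ d) :
    Real.sqrt (latNormSq 3 W) * latNormSq m U ≤ tameRHS m W U := by
  unfold tameRHS
  have : 0 ≤ Real.sqrt (latNormSq m W) * Real.sqrt (latNormSq 3 U) * Real.sqrt (latNormSq m U) := by positivity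
  linarith

omit [DecidableEq d] in
/-- The second summand is below `X`. [folklore] -/
theorem snd_le_tameRHS (m : ℕ) (W U : UnitAddTorus d → EuclideanSpace ℝ d) :
    Real.sqrt (latNormSq m W) * Real.sqrt (latNormSq 3 U) * Real.sqrt (latNormSq m U) ≤ tameRHS m W U := by
  unfold tameRHS
  have := latNormSq_nonneg m U
  have : 0 ≤ Real.sqrt (latNormSq 3 W) * latNormSq m U := by positivity
  linarith

/-- **The term bounds**: for `m ≥ 3` there is `K` with
`|∫ ⟪((∂ᵢᵃW)·∇)(∂ᵢ^{m-a}U), ∂ᵢᵐU⟫| ≤ K · X` for every `a ≤ m`. [folklore] -/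
theorem exists_term_le (hd : Fintype.card d = 3) {m : ℕ} (hm : 3 ≤ m) : ∃ K : ℝ, 0 ≤ K ∧
    ∀ (W U : UnitAddTorus d → EuclideanSpace ℝ d), IsSmooth W → IsSmooth U → ∀ (i : d), ∀ a ≤ m,
      |∫ x, ⟪Torus.convect ((Torus.partialDeriv i)^[a] W) ((Torus.partialDeriv i)^[m - a] U) x,
          (Torus.partialDeriv i)^[m] U x⟫_ℝ| ≤ K * tameRHS m W U := by
  obtain ⟨Cd, hCd0, hCd⟩ := exists_abs_divergence_le (d := d) hd
  obtain ⟨C₁, hC₁0, hC₁⟩ := exists_trilinear_sup_left (d := d) hd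
  obtain ⟨C₂, hC₂0, hC₂⟩ := exists_trilinear_sup_right (d := d) hd
  obtain ⟨C₃, hC₃0, hC₃⟩ := exists_trilinear_L4 (d := d) hd
  set q : ℝ := 4 * Real.pi ^ 2 with hq
  have hq1 : 1 ≤ q := by rw [hq]; nlinarith [Real.pi_gt_three]
  have hq0 : 0 ≤ q := by linarith
  -- a common (generous) constant: every `(4π²)`-power that occurs is `≤ q^(2m+1)`
  set Q : ℝ := q ^ (2 * m + 1) with hQ
  have hQ1 : 1 ≤ Q := one_le_pow₀ hq1
  have hpowQ : ∀ k ≤ 2 * m + 1, q ^ k ≤ Q := fun k hk => pow_le_pow_right₀ hq1 hk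
  refine ⟨(2⁻¹ * Cd + C₁ + C₂ + 2 * C₃) * Q, by positivity, fun W U hW hU i a ha => ?_⟩
  have hX0 := tameRHS_nonneg m W U
  have h3W := latNormSq_nonneg 3 W
  have hmW := latNormSq_nonneg m W
  have h3U := latNormSq_nonneg 3 U
  have hmU := latNormSq_nonneg m U
  set z := (Torus.partialDeriv i)^[m] U with hz
  have hzs : IsSmooth z := isSmooth_iterate_partialDeriv hU i m
  have hz2 : Real.sqrt (∫ x, ‖z x‖ ^ 2) ≤ Real.sqrt (q ^ m) * Real.sqrt (latNormSq m U) :=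
    sqrt_integral_norm_sq_iterate_le hU m i
  have hWa : IsSmooth ((Torus.partialDeriv i)^[a] W) := isSmooth_iterate_partialDeriv hW i a
  have hUa : IsSmooth ((Torus.partialDeriv i)^[m - a] U) := isSmooth_iterate_partialDeriv hU i (m - a)
  -- sqrt of powers of `q` are `≤ Q` (as `q ≥ 1`, `√(q^k) ≤ q^k ≤ Q`)
  have hsq : ∀ k ≤ 2 * m + 1, Real.sqrt (q ^ k) ≤ Q := fun k hk => by
    have h1 : 1 ≤ q ^ k := one_le_pow₀ hq1
    calc Real.sqrt (q ^ k) ≤ q ^ k := by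
          rw [Real.sqrt_le_left (by positivity)]
          nlinarith
      _ ≤ Q := hpowQ k hk
  -- the final comparison helper: `c * Y ≤ (…) * Q * X` whenever `c ≤ c' Q`-ish; we go case by case
  rcases Nat.eq_zero_or_pos a with rfl | ha0
  · -- ### a = 0: the transport term
    simp only [Function.iterate_zero, id_eq, Nat.sub_zero]
    have h := abs_integral_inner_convect_self_le_of_div hW hzs (hCd W hW)
    have hI : ∫ x, ‖z x‖ ^ 2 ≤ q ^ m * latNormSq m U := integral_norm_sq_iterate_le hU m i
    calc |∫ x, ⟪Torus.convect W z x, z x⟫_ℝ| ≤ 2⁻¹ * (Cd * Real.sqrt (latNormSq 3 W)) * ∫ x, ‖z x‖ ^ 2 := h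
      _ ≤ 2⁻¹ * (Cd * Real.sqrt (latNormSq 3 W)) * (q ^ m * latNormSq m U) :=
          mul_le_mul_of_nonneg_left hI (by positivity)
      _ = (2⁻¹ * Cd) * q ^ m * (Real.sqrt (latNormSq 3 W) * latNormSq m U) := by ring
      _ ≤ (2⁻¹ * Cd) * Q * tameRHS m W U := by
          refine mul_le_mul (mul_le_mul_of_nonneg_left (hpowQ m (by omega)) (by positivity)) (fst_le_tameRHS m W U)
            (by positivity) (by positivity)
      _ ≤ (2⁻¹ * Cd + C₁ + C₂ + 2 * C₃) * Q * tameRHS m W U := by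
          refine mul_le_mul_of_nonneg_right (mul_le_mul_of_nonneg_right ?_ (by positivity)) hX0
          linarith
  rcases eq_or_lt_of_le ha with rfl | ham
  · -- ### a = m: sup on `∇U`
    simp only [Nat.sub_self, Function.iterate_zero, id_eq]
    have h := hC₂ ((Torus.partialDeriv i)^[a] W) U z hWa hU hzs
    have hW0 : Real.sqrt (latNormSq 0 ((Torus.partialDeriv i)^[a] W)) ≤ Real.sqrt (q ^ a) * Real.sqrt (latNormSq a W) := by
      rw [← Real.sqrt_mul (by positivity)]
      refine Real.sqrt_le_sqrt ?_
      have := latNormSq_iterate_le hW 0 a i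
      rwa [zero_add] at this
    calc |∫ x, ⟪Torus.convect ((Torus.partialDeriv i)^[a] W) U x, z x⟫_ℝ|
        ≤ C₂ * Real.sqrt (latNormSq 0 ((Torus.partialDeriv i)^[a] W)) * Real.sqrt (latNormSq 3 U) *
            Real.sqrt (∫ x, ‖z x‖ ^ 2) := h
      _ ≤ C₂ * (Real.sqrt (q ^ a) * Real.sqrt (latNormSq a W)) * Real.sqrt (latNormSq 3 U) *
            (Real.sqrt (q ^ a) * Real.sqrt (latNormSq a U)) := by
          gcongr
      _ = C₂ * (Real.sqrt (q ^ a) * Real.sqrt (q ^ a)) *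
            (Real.sqrt (latNormSq a W) * Real.sqrt (latNormSq 3 U) * Real.sqrt (latNormSq a U)) := by ring
      _ ≤ C₂ * Q * tameRHS a W U := by
          refine mul_le_mul (mul_le_mul_of_nonneg_left ?_ hC₂0) (snd_le_tameRHS a W U) (by positivity) (by positivity)
          rw [Real.mul_self_sqrt (by positivity)]
          exact hpowQ _ (by omega)
      _ ≤ _ := by
          refine mul_le_mul_of_nonneg_right (mul_le_mul_of_nonneg_right ?_ (by positivity)) hX0
          linarith
  rcases eq_or_lt_of_le (Nat.one_le_iff_ne_zero.2 ha0.ne') with h1a | h1a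
  · -- ### a = 1: sup on `∂W`
    subst h1a
    have h := hC₁ ((Torus.partialDeriv i)^[1] W) ((Torus.partialDeriv i)^[m - 1] U) z hWa hUa hzs
    have hW1 : Real.sqrt (latNormSq 2 ((Torus.partialDeriv i)^[1] W)) ≤ Real.sqrt (q ^ 1) * Real.sqrt (latNormSq 3 W) := by
      rw [← Real.sqrt_mul (by positivity)]
      exact Real.sqrt_le_sqrt (latNormSq_iterate_le hW 2 1 i)
    have hU1 : Real.sqrt (latNormSq 1 ((Torus.partialDeriv i)^[m - 1] U)) ≤
        Real.sqrt (q ^ (m - 1)) * Real.sqrt (latNormSq m U) := by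
      rw [← Real.sqrt_mul (by positivity)]
      refine Real.sqrt_le_sqrt ?_
      have := latNormSq_iterate_le hU 1 (m - 1) i
      rwa [show 1 + (m - 1) = m by omega] at this
    calc |∫ x, ⟪Torus.convect ((Torus.partialDeriv i)^[1] W) ((Torus.partialDeriv i)^[m - 1] U) x, z x⟫_ℝ|
        ≤ C₁ * Real.sqrt (latNormSq 2 ((Torus.partialDeriv i)^[1] W)) *
            Real.sqrt (latNormSq 1 ((Torus.partialDeriv i)^[m - 1] U)) * Real.sqrt (∫ x, ‖z x‖ ^ 2) := h
      _ ≤ C₁ * (Real.sqrt (q ^ 1) * Real.sqrt (latNormSq 3 W)) * (Real.sqrt (q ^ (m - 1)) * Real.sqrt (latNormSq m U)) *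
            (Real.sqrt (q ^ m) * Real.sqrt (latNormSq m U)) := by gcongr
      _ = C₁ * (Real.sqrt (q ^ 1) * Real.sqrt (q ^ (m - 1)) * Real.sqrt (q ^ m)) *
            (Real.sqrt (latNormSq 3 W) * (Real.sqrt (latNormSq m U) * Real.sqrt (latNormSq m U))) := by ring
      _ ≤ C₁ * Q * tameRHS m W U := by
          rw [Real.mul_self_sqrt hmU]
          refine mul_le_mul (mul_le_mul_of_nonneg_left ?_ hC₁0) (fst_le_tameRHS m W U) (by positivity) (by positivity)
          rw [← Real.sqrt_mul (by positivity), ← Real.sqrt_mul (by positivity), ← pow_add, ← pow_add]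
          exact hsq _ (by omega)
      _ ≤ _ := by
          refine mul_le_mul_of_nonneg_right (mul_le_mul_of_nonneg_right ?_ (by positivity)) hX0
          linarith
  · -- ### 2 ≤ a ≤ m - 1: `L⁴ × L⁴` and interpolation
    have h := hC₃ ((Torus.partialDeriv i)^[a] W) ((Torus.partialDeriv i)^[m - a] U) z hWa hUa hzs
    have hWa' : Real.sqrt (latNormSq 1 ((Torus.partialDeriv i)^[a] W)) ≤ Real.sqrt (q ^ a) * Real.sqrt (latNormSq (a + 1) W) := by
      rw [← Real.sqrt_mul (by positivity)]
      refine Real.sqrt_le_sqrt ?_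
      have := latNormSq_iterate_le hW 1 a i
      rwa [add_comm] at this
    have hUa' : Real.sqrt (latNormSq 2 ((Torus.partialDeriv i)^[m - a] U)) ≤
        Real.sqrt (q ^ (m - a)) * Real.sqrt (latNormSq (m - a + 2) U) := by
      rw [← Real.sqrt_mul (by positivity)]
      refine Real.sqrt_le_sqrt ?_
      have := latNormSq_iterate_le hU 2 (m - a) i
      rwa [add_comm] at this
    -- interpolation of the levels `a + 1`, `m - a + 2`
    have htame := latProd_le_tame hW hU (p := a + 1) (q := m - a + 2) (m := m) (by omega) (by omega) (by omega)
    have hprod : Real.sqrt (latNormSq (a + 1) W) * Real.sqrt (latNormSq (m - a + 2) U) ≤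
        Real.sqrt (latNormSq 3 W) * Real.sqrt (latNormSq m U) + Real.sqrt (latNormSq m W) * Real.sqrt (latNormSq 3 U) := by
      rw [← Real.sqrt_mul (latNormSq_nonneg _ _), ← Real.sqrt_mul h3W, ← Real.sqrt_mul hmW]
      exact (Real.sqrt_le_sqrt htame).trans (sqrt_add_le_sqrt_add_sqrt (by positivity) (by positivity))
    calc |∫ x, ⟪Torus.convect ((Torus.partialDeriv i)^[a] W) ((Torus.partialDeriv i)^[m - a] U) x, z x⟫_ℝ|
        ≤ C₃ * Real.sqrt (latNormSq 1 ((Torus.partialDeriv i)^[a] W)) *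
            Real.sqrt (latNormSq 2 ((Torus.partialDeriv i)^[m - a] U)) * Real.sqrt (∫ x, ‖z x‖ ^ 2) := h
      _ ≤ C₃ * (Real.sqrt (q ^ a) * Real.sqrt (latNormSq (a + 1) W)) *
            (Real.sqrt (q ^ (m - a)) * Real.sqrt (latNormSq (m - a + 2) U)) *
            (Real.sqrt (q ^ m) * Real.sqrt (latNormSq m U)) := by gcongr
      _ = C₃ * (Real.sqrt (q ^ a) * Real.sqrt (q ^ (m - a)) * Real.sqrt (q ^ m)) *
            ((Real.sqrt (latNormSq (a + 1) W) * Real.sqrt (latNormSq (m - a + 2) U)) * Real.sqrt (latNormSq m U)) := by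
          ring
      _ ≤ C₃ * Q * ((Real.sqrt (latNormSq 3 W) * Real.sqrt (latNormSq m U) +
            Real.sqrt (latNormSq m W) * Real.sqrt (latNormSq 3 U)) * Real.sqrt (latNormSq m U)) := by
          refine mul_le_mul (mul_le_mul_of_nonneg_left ?_ hC₃0) (mul_le_mul_of_nonneg_right hprod (Real.sqrt_nonneg _))
            (by positivity) (by positivity)
          rw [← Real.sqrt_mul (by positivity), ← Real.sqrt_mul (by positivity), ← pow_add, ← pow_add]
          exact hsq _ (by omega)
      _ = C₃ * Q * tameRHS m W U := by
          show _ = C₃ * Q * (Real.sqrt (latNormSq 3 W) * latNormSq m U +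
            Real.sqrt (latNormSq m W) * Real.sqrt (latNormSq 3 U) * Real.sqrt (latNormSq m U))
          rw [add_mul, mul_assoc (Real.sqrt (latNormSq 3 W)), Real.mul_self_sqrt hmU]
      _ ≤ _ := by
          refine mul_le_mul_of_nonneg_right (mul_le_mul_of_nonneg_right ?_ (by positivity)) hX0
          linarith

/-- **The tame commutator estimate for pure derivatives of the convective derivative** on `T³`:
for `m ≥ 3` there is `C` with
`|∫ ⟪∂ᵢᵐ[(W·∇)U], ∂ᵢᵐU⟫| ≤ C (√(lat₃ W) latₘ U + √(latₘ W) √(lat₃ U) √(latₘ U))` for all smooth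
real fields `W, U` and every coordinate `i`. [cite: KatoLai1984, §4 (4.5)] -/
theorem exists_abs_integral_inner_iterate_convect_le (hd : Fintype.card d = 3) {m : ℕ} (hm : 3 ≤ m) :
    ∃ C : ℝ, 0 ≤ C ∧ ∀ (W U : UnitAddTorus d → EuclideanSpace ℝ d), IsSmooth W → IsSmooth U → ∀ i : d,
      |∫ x, ⟪(Torus.partialDeriv i)^[m] (Torus.convect W U) x, (Torus.partialDeriv i)^[m] U x⟫_ℝ| ≤
        C * tameRHS m W U := by
  obtain ⟨K, hK0, hK⟩ := exists_term_le (d := d) hd hm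
  refine ⟨(∑ a ∈ range (m + 1), (m.choose a : ℝ)) * K, by positivity, fun W U hW hU i => ?_⟩
  have hz : IsSmooth ((Torus.partialDeriv i)^[m] U) := isSmooth_iterate_partialDeriv hU i m
  rw [integral_inner_iterate_convect_eq_sum hW hU hz i m]
  calc |∑ a ∈ range (m + 1), (m.choose a : ℝ) *
        ∫ x, ⟪Torus.convect ((Torus.partialDeriv i)^[a] W) ((Torus.partialDeriv i)^[m - a] U) x,
          (Torus.partialDeriv i)^[m] U x⟫_ℝ|
      ≤ ∑ a ∈ range (m + 1), |(m.choose a : ℝ) *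
        ∫ x, ⟪Torus.convect ((Torus.partialDeriv i)^[a] W) ((Torus.partialDeriv i)^[m - a] U) x,
          (Torus.partialDeriv i)^[m] U x⟫_ℝ| := abs_sum_le_sum_abs _ _
    _ ≤ ∑ a ∈ range (m + 1), (m.choose a : ℝ) * (K * tameRHS m W U) := by
        refine sum_le_sum fun a ha => ?_
        rw [abs_mul, Nat.abs_cast]
        exact mul_le_mul_of_nonneg_left (hK W U hW hU i a (Nat.lt_succ_iff.1 (mem_range.1 ha))) (Nat.cast_nonneg _)
    _ = (∑ a ∈ range (m + 1), (m.choose a : ℝ)) * K * tameRHS m W U := by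
        rw [sum_mul, sum_mul]
        exact sum_congr rfl fun a _ => by ring

end Torus

end Literature.Analysis.FluidPDE
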